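import Summits.Ventures.PercRepro.MSRMStarFacetCount

/-!
# Sub-lemma (a) of the pair lemma, the theorem: at least `|K| + 2` free faces

Continues `MSRMStarFacetCount.lean` (the setting `FacetData`, the bridge to Theorem (MIN) and the
consequences of rigidity). Here: an *admissible family* is a set of minimal members of `K` with a
common `ub`-part `c` and pairwise disjoint `u₀`-parts (`Adm`); for such a family `c ∪ ⋃ d_i` is a
face (`union_biUnion_mem`, rigidity at the members one at a time), a maximal family cannot be
extended, so the sign at the member `c ∪ ⋃ d_i` forces `u₀ ∖ ⋃ d_i` to be a face
(`biUnion_notMem_freeFaces_of_max`), and adding the `d_i` back one at a time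
(`compl_sdiff_union_biUnion_mem`) makes `u₀` itself a face — against `u₀ ∉ P`. Hence the excess
is not one, and with Lemma X it is at least two: **`card_add_two_le_card_freeFaces`**
(dossier Addendum 62 supplement 3).
-/

namespace PercRepro.MSTight

open Finset
open scoped FinsetFamily

variable {α : Type*} [DecidableEq α]

section Facet

variable {G : Finset α} {P K : Finset (Finset α)} {ub : Finset α}

namespace FacetData

variable (h : FacetData G P K ub)
include h

/-! ### A maximal family of minimal members with a common `ub`-part and disjoint `u₀`-parts -/

omit h in
/-- A family `𝓕` of minimal members of `K` with `ub`-part `c` and pairwise disjoint `u₀`-parts. -/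
def Adm (G : Finset α) (K : Finset (Finset α)) (ub c : Finset α) (𝓕 : Finset (Finset α)) : Prop :=
  (∀ m ∈ 𝓕, IsMinIn K m ∧ m ∩ ub = c) ∧
    ∀ m ∈ 𝓕, ∀ m' ∈ 𝓕, m ≠ m' → Disjoint (m ∩ (G \ ub)) (m' ∩ (G \ ub))

omit h in
/-- The `u₀`-parts of an admissible family are disjoint from the `u₀`-part of a member outside
it. -/
theorem disjoint_biUnion_of_adm {c : Finset α} {𝓕 : Finset (Finset α)} (hF : Adm G K ub c 𝓕)
    {m : Finset α} (hm : m ∈ 𝓕) {𝓖 : Finset (Finset α)} (hG : 𝓖 ⊆ 𝓕) (hmG : m ∉ 𝓖) :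
    Disjoint (𝓖.biUnion fun m' => m' ∩ (G \ ub)) (m ∩ (G \ ub)) := by
  rw [disjoint_left]
  intro x hx hxm
  obtain ⟨m', hm', hx'⟩ := mem_biUnion.1 hx
  have hne : m' ≠ m := fun e => hmG (e ▸ hm')
  exact disjoint_left.1 (hF.2 m' (hG hm') m hm hne) hx' hxm

/-- **The member `c ∪ ⋃ d_i`**: for an admissible family, `c` together with the `u₀`-parts of any
subfamily is a face (rigidity at the members, one at a time). -/
theorem union_biUnion_mem (hrig : ∀ m, IsMinIn K m → crossSet P m = {ub \ m}) {c : Finset α}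
    (hc : c ∈ P) {𝓕 : Finset (Finset α)} (hF : Adm G K ub c 𝓕) :
    ∀ 𝓖 ⊆ 𝓕, c ∪ 𝓖.biUnion (fun m => m ∩ (G \ ub)) ∈ P := by
  intro 𝓖
  induction 𝓖 using Finset.induction_on with
  | empty => intro _; simpa using hc
  | insert m 𝓖 hmG ih =>
    intro hsub
    have hm : m ∈ 𝓕 := hsub (mem_insert_self m 𝓖)
    have hG : 𝓖 ⊆ 𝓕 := fun x hx => hsub (mem_insert_of_mem hx)
    have ih' := ih hG
    obtain ⟨hmin, hcm⟩ := hF.1 m hm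
    have hv : 𝓖.biUnion (fun m' => m' ∩ (G \ ub)) ∈ P := h.mem_of_subset ih' subset_union_right
    have hd : Disjoint (𝓖.biUnion fun m' => m' ∩ (G \ ub)) m := by
      rw [disjoint_left]
      intro x hx hxm
      obtain ⟨m', hm', hx'⟩ := mem_biUnion.1 hx
      have hxu : x ∈ G \ ub := (mem_inter.1 hx').2
      exact disjoint_left.1 (disjoint_biUnion_of_adm hF hm hG hmG) hx (mem_inter.2 ⟨hxm, hxu⟩)
    have hne : 𝓖.biUnion (fun m' => m' ∩ (G \ ub)) ≠ ub \ m := by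
      intro e
      obtain ⟨a, ha⟩ := h.sdiff_nonempty hmin.1
      have : a ∈ 𝓖.biUnion (fun m' => m' ∩ (G \ ub)) := e ▸ ha
      obtain ⟨_, _, ha'⟩ := mem_biUnion.1 this
      exact (mem_sdiff.1 (mem_inter.1 ha').2).2 (mem_sdiff.1 ha).1
    have hmem := union_mem_of_rigid hrig hmin hv hd hne
    rw [biUnion_insert]
    refine h.mem_of_subset hmem ?_
    intro x hx
    rcases mem_union.1 hx with hxc | hx'
    · exact mem_union_right _ (by rw [← hcm] at hxc; exact (mem_inter.1 hxc).1)
    · rcases mem_union.1 hx' with hx1 | hx2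
      · exact mem_union_right _ (mem_inter.1 hx1).1
      · exact mem_union_left _ hx2

/-- **The complement of `⋃ d_i` extends**: if `u₀ ∖ D` is a face, adding the `u₀`-parts of the
family one at a time stays inside `P`. -/
theorem compl_sdiff_union_biUnion_mem (hrig : ∀ m, IsMinIn K m → crossSet P m = {ub \ m})
    {c : Finset α} {𝓕 : Finset (Finset α)} (hF : Adm G K ub c 𝓕)
    (hv0 : (G \ ub) \ 𝓕.biUnion (fun m => m ∩ (G \ ub)) ∈ P)
    (hne0 : ((G \ ub) \ 𝓕.biUnion (fun m => m ∩ (G \ ub))).Nonempty) :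
    ∀ 𝓖 ⊆ 𝓕, (G \ ub) \ 𝓕.biUnion (fun m => m ∩ (G \ ub)) ∪
      𝓖.biUnion (fun m => m ∩ (G \ ub)) ∈ P := by
  intro 𝓖
  induction 𝓖 using Finset.induction_on with
  | empty => intro _; simpa using hv0
  | insert m 𝓖 hmG ih =>
    intro hsub
    have hm : m ∈ 𝓕 := hsub (mem_insert_self m 𝓖)
    have hG : 𝓖 ⊆ 𝓕 := fun x hx => hsub (mem_insert_of_mem hx)
    have ih' := ih hG
    obtain ⟨hmin, hcm⟩ := hF.1 m hm
    set v := (G \ ub) \ 𝓕.biUnion (fun m => m ∩ (G \ ub)) ∪ 𝓖.biUnion (fun m => m ∩ (G \ ub))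
      with hvdef
    have hvu : v ⊆ G \ ub := by
      intro x hx
      rcases mem_union.1 hx with hx | hx
      · exact (mem_sdiff.1 hx).1
      · obtain ⟨_, _, hx'⟩ := mem_biUnion.1 hx
        exact (mem_inter.1 hx').2
    have hd : Disjoint v m := by
      rw [disjoint_left]
      intro x hx hxm
      have hxu : x ∈ G \ ub := hvu hx
      have hxd : x ∈ m ∩ (G \ ub) := mem_inter.2 ⟨hxm, hxu⟩
      rcases mem_union.1 hx with hx1 | hx2
      · exact (mem_sdiff.1 hx1).2 (mem_biUnion.2 ⟨m, hm, hxd⟩)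
      · exact disjoint_left.1 (disjoint_biUnion_of_adm hF hm hG hmG) hx2 hxd
    have hne : v ≠ ub \ m := by
      intro e
      obtain ⟨a, ha⟩ := hne0
      have ha' : a ∈ v := mem_union_left _ ha
      rw [e] at ha'
      exact (mem_sdiff.1 (hvu (e ▸ ha'))).2 (mem_sdiff.1 ha').1
    have hmem := union_mem_of_rigid hrig hmin ih' hd hne
    rw [biUnion_insert]
    refine h.mem_of_subset hmem ?_
    intro x hx
    rcases mem_union.1 hx with hx1 | hx2
    · exact mem_union_left _ (mem_union_left _ hx1)
    · rcases mem_union.1 hx2 with hx3 | hx4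
      · exact mem_union_right _ (mem_inter.1 hx3).1
      · exact mem_union_left _ (mem_union_right _ hx4)

/-- A maximal admissible family cannot be extended: the union of its `u₀`-parts is not free. -/
theorem biUnion_notMem_freeFaces_of_max (hrig : ∀ m, IsMinIn K m → crossSet P m = {ub \ m})
    {c : Finset α} {𝓕 : Finset (Finset α)} (hF : Adm G K ub c 𝓕) (hne : 𝓕.Nonempty)
    (hmax : ∀ 𝓕' : Finset (Finset α), Adm G K ub c 𝓕' → 𝓕'.card ≤ 𝓕.card) :
    𝓕.biUnion (fun m => m ∩ (G \ ub)) ∉ freeFaces P K := by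
  intro hfree
  obtain ⟨_, k, hk, hd⟩ := mem_freeFaces.1 hfree
  obtain ⟨m'', hm'', hsub⟩ := exists_isMinIn_subset hk
  obtain ⟨m₀, hm₀⟩ := hne
  obtain ⟨hmin₀, hc₀⟩ := hF.1 m₀ hm₀
  have hdD : Disjoint (m'' ∩ (G \ ub)) (𝓕.biUnion fun m => m ∩ (G \ ub)) :=
    (Finset.disjoint_of_subset_left (inter_subset_left.trans hsub) hd)
  have hd0 : Disjoint (m'' ∩ (G \ ub)) (m₀ ∩ (G \ ub)) :=
    Finset.disjoint_of_subset_right (subset_biUnion_of_mem (fun m => m ∩ (G \ ub)) hm₀) hdD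
  have hc'' : m'' ∩ ub = c := by
    rw [h.inter_ub_eq_of_rigid hrig hm'' hmin₀ hd0, hc₀]
  have hnotin : m'' ∉ 𝓕 := by
    intro hin
    obtain ⟨a, ha⟩ := h.inter_compl_nonempty hm''.1
    exact disjoint_left.1 hdD ha (mem_biUnion.2 ⟨m'', hin, ha⟩)
  have hadm : Adm G K ub c (insert m'' 𝓕) := by
    refine ⟨?_, ?_⟩
    · intro m hm
      rcases mem_insert.1 hm with rfl | hm
      · exact ⟨hm'', hc''⟩
      · exact hF.1 m hm
    · intro m hm m' hm' hne'
      have key : ∀ x ∈ 𝓕, Disjoint (m'' ∩ (G \ ub)) (x ∩ (G \ ub)) := fun x hx =>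
        Finset.disjoint_of_subset_right (subset_biUnion_of_mem (fun m => m ∩ (G \ ub)) hx) hdD
      rcases mem_insert.1 hm with h1 | h1 <;> rcases mem_insert.1 hm' with h2 | h2
      · exact absurd (h1.trans h2.symm) hne'
      · rw [h1]; exact key m' h2
      · rw [h2]; exact (key m h1).symm
      · exact hF.2 m h1 m' h2 hne'
  have := hmax _ hadm
  rw [card_insert_of_notMem hnotin] at this
  omega

/-- **Sub-lemma (a).** There are at least `|K| + 2` free faces. -/
theorem card_add_two_le_card_freeFaces : K.card + 2 ≤ (freeFaces P K).card := by
  classical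
  by_contra hlt
  push Not at hlt
  have h1 : exc G P (upGen G K) = 1 := by
    have := h.one_le_exc
    rw [h.exc_eq] at this ⊢
    omega
  have hrig : ∀ m, IsMinIn K m → crossSet P m = {ub \ m} := fun m hm => h.crossSet_eq h1 hm
  -- a minimal member `m₀` and a maximal admissible family containing it
  obtain ⟨k, hk⟩ := h.nonempty
  obtain ⟨m₀, hm₀, _⟩ := exists_isMinIn_subset hk
  set c := m₀ ∩ ub with hc
  have hcP : c ∈ P := h.mem_of_subset (h.KP hm₀.1) inter_subset_left
  have hadm₀ : Adm G K ub c {m₀} := by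
    refine ⟨fun m hm => ?_, fun m hm m' hm' hne => ?_⟩
    · rw [mem_singleton] at hm; subst hm; exact ⟨hm₀, rfl⟩
    · rw [mem_singleton] at hm hm'; subst hm; subst hm'; exact absurd rfl hne
  obtain ⟨𝓕, hF, hmax⟩ := exists_max_image (K.powerset.filter fun 𝓕 => Adm G K ub c 𝓕) card
    ⟨{m₀}, mem_filter.2 ⟨mem_powerset.2 (singleton_subset_iff.2 hm₀.1), hadm₀⟩⟩
  rw [mem_filter] at hF
  have hmax' : ∀ 𝓕' : Finset (Finset α), Adm G K ub c 𝓕' → 𝓕'.card ≤ 𝓕.card := by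
    intro 𝓕' hF'
    refine hmax 𝓕' (mem_filter.2 ⟨mem_powerset.2 fun m hm => (hF'.1 m hm).1.1, hF'⟩)
  have hne : 𝓕.Nonempty := by
    rw [nonempty_iff_ne_empty]
    rintro rfl
    have := hmax' {m₀} hadm₀
    simp at this
  set D := 𝓕.biUnion (fun m => m ∩ (G \ ub)) with hD
  have hDu : D ⊆ G \ ub := by
    intro x hx
    obtain ⟨_, _, hx'⟩ := mem_biUnion.1 hx
    exact (mem_inter.1 hx').2
  -- the member `c ∪ D` and the sign at it
  have hcD : c ∪ D ∈ P := h.union_biUnion_mem hrig hcP hF.2 𝓕 (Subset.refl 𝓕)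
  have hnotfree := h.biUnion_notMem_freeFaces_of_max hrig hF.2 hne hmax'
  have hv0 : (G \ ub) \ D ∈ P := by
    rcases h.signs _ hcD with hfree | hP
    · exfalso
      apply hnotfree
      have : (c ∪ D) ∩ (G \ ub) = D := by
        ext x
        simp only [mem_inter, mem_union]
        constructor
        · rintro ⟨(hxc | hxD), hxu⟩
          · exact absurd (mem_sdiff.1 hxu).2 (fun h' => h' (mem_inter.1 (hc ▸ hxc)).2)
          · exact hxD
        · intro hxD
          exact ⟨Or.inr hxD, hDu hxD⟩
      rw [this] at hfree
      exact hfree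
    · have : (G \ ub) \ (c ∪ D) = (G \ ub) \ D := by
        ext x
        simp only [mem_sdiff, mem_union, not_or]
        constructor
        · rintro ⟨hx, _, hxD⟩; exact ⟨hx, hxD⟩
        · rintro ⟨hx, hxD⟩
          refine ⟨hx, fun hxc => ?_, hxD⟩
          exact hx.2 (mem_inter.1 (hc ▸ hxc)).2
      rw [this] at hP
      exact hP
  have hne0 : ((G \ ub) \ D).Nonempty := by
    rw [nonempty_iff_ne_empty, Ne, sdiff_eq_empty_iff_subset]
    intro hsub
    exact h.compl_notMem (h.mem_of_subset hcD (hsub.trans subset_union_right))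
  have hall := h.compl_sdiff_union_biUnion_mem hrig hF.2 hv0 hne0 𝓕 (Subset.refl 𝓕)
  rw [sdiff_union_of_subset hDu] at hall
  exact h.compl_notMem hall

end FacetData

end Facet

end PercRepro.MSTight
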